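/-
Copyright: statement-level skeleton of a published paper (lit-balaban cell, reader/typer r15). No proof claims beyond
what the kernel checks below.
-/
import Mathlib
import Literature.MathematicalPhysics.QuantumFieldTheory.Balaban1983to89.B1Sect1Statements
import Literature.MathematicalPhysics.QuantumFieldTheory.Balaban1983to89.B1Sect3Statements

/-!
# B3 — T. Bałaban, *(Higgs)₂,₃ quantum fields in a finite volume. III. Renormalization*, CMP **88** (1983) 411–445,
Sect. 1 pp. 416–418: the two-point function (1.19), the action (1.20), the self-energy expansion (1.21), the defining
equations of the mass counterterm (1.23) and the vacuum-energy counterterm (1.24)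

statement-level skeleton of published theorems with citation tags; proofs where landed; nothing here is a claim about
the Yang–Mills mass gap

v1.1 (append-only, r15 gen 11): §(1.24)R — `E1of124R` := r01's repaired `ModelData.e1R` (right `λ`-derivatives at `0⁺`),
the decl of record for row B3.Eq1.24 after the semantic audit `B1Eq113OneSidedDerivatives` (typer, p330976) and the repair
`B1Sect1Statements` v1.1 (r01, p331274); `E1of124`/`e1_eq_pertSum362_sub` kept verbatim (located two-sided defect, see §(1.24)R).

Source: held text `paper:balaban1983-higgs-2-3-quantum-fields-finite-volume` (journal page = PDF page + 410); displays
read on the ×2 renders `pub-balaban/b2b-balaban-ref1/pages/1983-cmp88-higgs23-III/1983-cmp88-higgs23-III-p006, p007,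
p008-x2.png` (pp. 416, 417, 418).  SKELETON rows B3.Eq1.19-1.22, B3.Eq1.23, B3.Eq1.24 of
`HOME/lit-balaban-r15/ROWS-B3.md` (fold owner r15).  REUSED, nothing re-declared: the concrete lattice model of
the typer's `HiggsLattice` (`action` (I.1.11), `partitionFn` (I.1.10)), r14's `B1Sect1Statements.ModelData` (the
model's fixed data incl. the counterterm function `δmsq`; `zOf`, `logZ`, `e1` = (I.1.13)), r12's
`B1Sect3Statements.pertSum362` (cf. r15's `B3Sect1Counterterms` for (1.5), (1.26), (1.29)–(1.30)).

## What is typed here, and how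

* **(1.19)** p. 416, verbatim: *"It is determined by the two-point Schwinger function G^ε_{ab}(x, x′) =
  ⟨φ_a(x)φ_b(x′)⟩^ε = (Z^ε)^{−1}∫dA∫dφ e^{−S^ε(A,φ)}φ_a(x)φ_b(x′), x, x′ ∈ T_ε, (1.19)"* — `twoPoint`, CONCRETE: the
  normalized expectation over the product Lebesgue measure on `(bonds → ℝ) × (sites → ℝ^N)` of the finest torus, with
  `S^ε` = (1.20) = `action120` and `Z^ε` = `HiggsLattice.partitionFn` at the same couplings (= r14's
  `ModelData.zOf … 0`, `z120_eq_zOf`).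
* **(1.20)** p. 416, verbatim: *"S^ε(A, φ) = ½⟨φ, (−Δ^ε_A + m²)φ⟩ + Σ_{x∈T_ε} ε^d(λ|φ(x)|⁴ + ½δm²|φ(x)|²) +
  ½⟨A, (−Δ^ε + μ₀²)A⟩, (1.20)"* — `action120` := the typer's `HiggsLattice.action` ((I.1.11)) at bare mass
  `m₀² = m² + δm²` and `E = 0` (p. 418: *"In S^ε, defined in (I.1.11), we of course have dropped the term E"*); the
  printed grouping is PROVED (`action120_eq`).
* **(1.21)** p. 416, verbatim: *"The function G^ε has a perturbative expansion of the following structure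
  G^ε = Σ_{n=0}^{∞} C^ε_0[(−δm² + Σ^ε + ∂^{ε*}Σ^ε_1 + Σ^{ε*}_1∂^ε + ∂^{ε*}Σ^ε_2∂^ε)C^ε_0]ⁿ, (1.21) where C^ε_0 =
  (−Δ^ε_0 + m²)^{−1} and Σ^ε, Σ^ε_1, Σ^ε_2 are given by amputated, one-particle-irreducible graphs of the expansion of
  G^ε"* — in an arbitrary ring of operators: the self-energy insertion `selfEnergy121`, the `n`-th term `dysonTerm`,
  the resummed form `Eq121` (`G = C₀ + G·X·C₀`, of which the printed series is the iteration) and, PROVED, the exact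
  finite expansion `dyson_partial` (`G = Σ_{n<N} C₀(XC₀)ⁿ + G(XC₀)^N` under `Eq121`).  The 1PI objects `Σ^ε`,
  `Σ^ε_1`, `Σ^ε_2` themselves (graph expansions) are letters; **(1.22)** (the first terms of `Σ^ε`, an open-ended
  display "+ …" with pictures) is NOT typed.
* **(1.23)** p. 417: *"More exactly we write δm² = Σ_{2≦α+2β≦4} e^αλ^β δm²_{(α,β)} … The counterterms δm²_{(α,β)}
  are defined by the equations −δm²_{(α,β)} + Σ_{x∈T_ε} ε^dΣ^ε_{(α,β)}(x) = 0. … we define δm²_G by the equation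
  −δm²_G + Σ_{x∈T_ε} ε^dΣ^ε_G(x) = 0"* — `idx123`, `dm2Coeff`, `dm2Of123`, `dm2Graph` over the supplied coefficient
  functions `Σ^ε_{(α,β)}`, `Σ^ε_G` (their graph expansion is not modelled); the displayed list (1.23) of the nine
  lowest counterterm graphs ("+ …") is NOT reproduced.
* **(1.24)** p. 417, verbatim: *"E₁ = Σ_{1≦α+β≦n̄} (1/(α!β!)) e^αλ^β (∂^{α+β}/∂e^α∂λ^β log∫dA∫dφ e^{−S^ε(A,φ)})|_{e=λ=0}
  (1.24)"* — this is (I.1.13) of paper I without the constant `E` under the logarithm, already typed CONCRETELY by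
  r14 as `B1Sect1Statements.ModelData.e1` (decl of record); here `E1of124` names it for B3 and the bridge to r12's
  double Taylor sum is PROVED (`e1_eq_pertSum362_sub`: `E₁ = pertSum362 (log Z) e λ n̄ − log Z(0,0)`).  The
  sentence p. 418 *"it is sufficient to take the terms … restricted by the condition 2 ≦ α + 2β ≦ 6; the other terms
  are convergent as ε → 0"* is a convergence claim and is NOT typed.
-/

open scoped BigOperators
open _root_.MeasureTheory

namespace Literature.MathematicalPhysics.QuantumFieldTheory.Balaban1983to89.B3Sect1TwoPoint

open Literature.MathematicalPhysics.QuantumFieldTheory.Balaban1983to89.HiggsLattice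
open Literature.MathematicalPhysics.QuantumFieldTheory.Balaban1983to89.B1Sect1Statements

/-! ## (1.20), (1.19) — the action and the two-point function of the ε-lattice model -/

section TwoPoint

variable (D : ModelData) (P : Params)

/-- **(1.20)** p. 416 [PDF 6], verbatim: *"where S^ε(A, φ) is the lattice action of the model given by
S^ε(A, φ) = ½⟨φ, (−Δ^ε_A + m²)φ⟩ + Σ_{x∈T_ε} ε^d(λ|φ(x)|⁴ + ½δm²|φ(x)|²) + ½⟨A, (−Δ^ε + μ₀²)A⟩, (1.20)"* — the
typer's (I.1.11) `HiggsLattice.action` on `T_ε = T^{(0)}` at the model's charge `(e, q)`, couplings `λ`, bare mass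
`m₀² = m² + δm²(ε, e, λ)` (`ModelData.δmsq`), vector mass `μ₀²`, and `E = 0` (p. 418: *"In S^ε, defined in (I.1.11), we
of course have dropped the term E"*). [cite: Balaban1983Higgs3, (1.20) p.416] -/
noncomputable def action120 (A : VecField P 0) (φ : ScalarField P 0 D.N) : ℝ :=
  action D.C ⟨D.msq + D.δmsq P.ε D.C.e D.lam, D.lam, D.mu0sq, 0⟩ A φ

/-- (1.20) in the PRINTED grouping: `½[⟨φ,−Δ^ε_Aφ⟩ + m²⟨φ,φ⟩] + Σ_x ε^d(λ|φ(x)|⁴ + ½δm²|φ(x)|²) + ½[⟨A,−Δ^εA⟩ +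
μ₀²⟨A,A⟩]` (with `⟨φ,−Δ^ε_Aφ⟩ = Σ_b ε^d|(D^ε_Aφ)(b)|²` = `covLaplaceForm`, `⟨A,−Δ^εA⟩` = `vecLaplaceForm`). PROVED.
[cite: Balaban1983Higgs3, (1.20) p.416] -/
theorem action120_eq (A : VecField P 0) (φ : ScalarField P 0 D.N) :
    action120 D P A φ
      = (covLaplaceForm D.C A φ + D.msq * ∑ x : Site P 0, P.mesh 0 ^ P.d * ‖φ x‖ ^ 2) / 2
        + ∑ x : Site P 0, P.mesh 0 ^ P.d * (D.lam * ‖φ x‖ ^ 4 + D.δmsq P.ε D.C.e D.lam / 2 * ‖φ x‖ ^ 2)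
        + (vecLaplaceForm A + ∑ b : PBond P 0, P.mesh 0 ^ P.d * (D.mu0sq * A b ^ 2)) / 2 := by
  unfold action120 action potential
  have h : ∀ x : Site P 0,
      P.mesh 0 ^ P.d * ((D.msq + D.δmsq P.ε D.C.e D.lam) / 2 * ‖φ x‖ ^ 2 + D.lam * ‖φ x‖ ^ 4)
        = D.msq * (P.mesh 0 ^ P.d * ‖φ x‖ ^ 2) / 2
          + P.mesh 0 ^ P.d * (D.lam * ‖φ x‖ ^ 4 + D.δmsq P.ε D.C.e D.lam / 2 * ‖φ x‖ ^ 2) := by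
    intro x; ring
  simp_rw [h, Finset.sum_add_distrib, ← Finset.sum_div, ← Finset.mul_sum]
  ring

/-- `Z^ε` of (1.19): the partition function (I.1.10) of the action (1.20) (`HiggsLattice.partitionFn`; no constant `E`).
[cite: Balaban1983Higgs3, (1.19) p.416] -/
noncomputable def z120 : ℝ :=
  partitionFn P 0 D.N D.C ⟨D.msq + D.δmsq P.ε D.C.e D.lam, D.lam, D.mu0sq, 0⟩

/-- `Z^ε` of (1.19) is r14's `ModelData.zOf` at the physical couplings and `E = 0` (definitional).
[cite: Balaban1983Higgs3, (1.19) p.416] -/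
theorem z120_eq_zOf : z120 D P = D.zOf P D.C.e D.lam 0 := rfl

/-- **(1.19)** p. 416 [PDF 6], verbatim: *"Let us begin with the mass renormalization counterterm δm². It is determined by
the two-point Schwinger function G^ε_{ab}(x, x′) = ⟨φ_a(x)φ_b(x′)⟩^ε = (Z^ε)^{−1}∫dA∫dφ e^{−S^ε(A,φ)}φ_a(x)φ_b(x′),
x, x′ ∈ T_ε, (1.19)"* — CONCRETE over the typer's model: product Lebesgue measure on `(bonds → ℝ) × (sites → ℝ^N)`
of `T_ε = T^{(0)}` (as in `HiggsLattice.partitionFn`), `S^ε = action120`, components `a, b ∈ {1, …, N}`.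
[cite: Balaban1983Higgs3, (1.19) p.416] -/
noncomputable def twoPoint (a b : Fin D.N) (x x' : Site P 0) : ℝ :=
  (z120 D P)⁻¹ *
    ∫ Φ : VecField P 0 × ScalarField P 0 D.N, Real.exp (-action120 D P Φ.1 Φ.2) * (Φ.2 x a * Φ.2 x' b)

/-- (1.19) is symmetric under `(a, x) ↔ (b, x′)` (the integrand is). PROVED. [cite: Balaban1983Higgs3, (1.19) p.416] -/
theorem twoPoint_symm (a b : Fin D.N) (x x' : Site P 0) :
    twoPoint D P a b x x' = twoPoint D P b a x' x := by
  unfold twoPoint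
  congr 1
  refine integral_congr_ae (Filter.Eventually.of_forall fun Φ => ?_)
  simp only [mul_comm (Φ.2 x a)]

end TwoPoint

/-! ## (1.21) — the self-energy (Dyson) expansion, in a ring of operators -/

section Dyson

variable {R : Type*} [Ring R]

/-- The insertion of (1.21): `X = −δm² + Σ^ε + ∂^{ε*}Σ^ε_1 + Σ^{ε*}_1∂^ε + ∂^{ε*}Σ^ε_2∂^ε` in a ring of operators on
fields on `T_ε` (`dm2` = the multiplication operator `δm²`, `d`/`ds` = `∂^ε`/`∂^{ε*}`, `Sg`, `Sg1`, `Sg1s`, `Sg2` =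
the amputated 1PI pieces `Σ^ε`, `Σ^ε_1`, `Σ^{ε*}_1`, `Σ^ε_2` — letters here). [cite: Balaban1983Higgs3, (1.21) p.416] -/
def selfEnergy121 (dm2 Sg Sg1 Sg1s Sg2 d ds : R) : R :=
  -dm2 + Sg + ds * Sg1 + Sg1s * d + ds * Sg2 * d

/-- The `n`-th term `C^ε_0 [X C^ε_0]ⁿ` of the series (1.21). [cite: Balaban1983Higgs3, (1.21) p.416] -/
def dysonTerm (C0 X : R) (n : ℕ) : R :=
  C0 * (X * C0) ^ n

/-- **(1.21)** p. 416 [PDF 6], verbatim: *"The function G^ε has a perturbative expansion of the following structure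
G^ε = Σ_{n=0}^{∞} C^ε_0[(−δm² + Σ^ε + ∂^{ε*}Σ^ε_1 + Σ^{ε*}_1∂^ε + ∂^{ε*}Σ^ε_2∂^ε)C^ε_0]ⁿ, (1.21) where C^ε_0 = (−Δ^ε_0 + m²)^{−1}"*
— typed in its RESUMMED form (the Dyson equation) `G = C₀ + G·X·C₀`, of which the printed series is the iteration
(`dyson_partial`); as a perturbative (formal power series in `e, λ`) identity the two are equivalent order by order.
[cite: Balaban1983Higgs3, (1.21) p.416] -/
def Eq121 (G C0 X : R) : Prop :=
  G = C0 + G * X * C0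

/-- The exact finite form of (1.21): under the Dyson equation, for every `N`,
`G = Σ_{n<N} C₀(XC₀)ⁿ + G(XC₀)^N` (iterate `G = C₀ + GXC₀` `N` times). PROVED. [cite: Balaban1983Higgs3, (1.21) p.416] -/
theorem dyson_partial {G C0 X : R} (h : Eq121 G C0 X) (N : ℕ) :
    G = (∑ n ∈ Finset.range N, dysonTerm C0 X n) + G * (X * C0) ^ N := by
  induction N with
  | zero => simp
  | succ N ih =>
      rw [Finset.sum_range_succ]
      calc G = (∑ n ∈ Finset.range N, dysonTerm C0 X n) + G * (X * C0) ^ N := ih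
        _ = (∑ n ∈ Finset.range N, dysonTerm C0 X n) + (C0 + G * X * C0) * (X * C0) ^ N := by
            rw [← h]
        _ = (∑ n ∈ Finset.range N, dysonTerm C0 X n) + dysonTerm C0 X N + G * (X * C0) ^ (N + 1) := by
            rw [dysonTerm, pow_succ']
            noncomm_ring

/-- If the insertion is nilpotent of order `N` against `C₀` (`(XC₀)^N = 0`, e.g. at a finite perturbative order), the
series (1.21) terminates and equals `G`. PROVED. [cite: Balaban1983Higgs3, (1.21) p.416] -/
theorem eq121_sum_of_nilpotent {G C0 X : R} (h : Eq121 G C0 X) {N : ℕ} (hN : (X * C0) ^ N = 0) :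
    G = ∑ n ∈ Finset.range N, dysonTerm C0 X n := by
  have := dyson_partial h N
  rwa [hN, mul_zero, add_zero] at this

end Dyson

/-! ## (1.23) — the defining equations of the mass counterterm -/

section Eq123

variable {X : Type*} [Fintype X]

/-- The index set of (1.23): orders `(α, β)` with `2 ≤ α + 2β ≤ 4` (p. 417: *"δm² will be defined by the terms of order
≦ 4. More exactly we write δm² = Σ_{2≦α+2β≦4} e^αλ^βδm²_{(α,β)}"*). [cite: Balaban1983Higgs3, (1.23) p.417] -/
def idx123 : Finset (ℕ × ℕ) :=
  (Finset.range 5 ×ˢ Finset.range 3).filter fun ab => 2 ≤ ab.1 + 2 * ab.2 ∧ ab.1 + 2 * ab.2 ≤ 4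

/-- The seven orders of (1.23): `(2,0), (3,0), (4,0), (0,1), (1,1), (2,1), (0,2)`. PROVED (by `decide`).
[cite: Balaban1983Higgs3, (1.23) p.417] -/
theorem idx123_eq : idx123 = {(2, 0), (3, 0), (4, 0), (0, 1), (1, 1), (2, 1), (0, 2)} := by
  decide

/-- p. 417, verbatim: *"The counterterms δm²_{(α,β)} are defined by the equations −δm²_{(α,β)} + Σ_{x∈T_ε} ε^dΣ^ε_{(α,β)}(x) = 0"*,
i.e. `δm²_{(α,β)} := Σ_{x∈T_ε} ε^d Σ^ε_{(α,β)}(x)` for the supplied order-`(α, β)` coefficient `Σ^ε_{(α,β)}` of the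
self-energy (a function on `T_ε`; "internal indices understood"). [cite: Balaban1983Higgs3, (1.23) p.417] -/
def dm2Coeff (epsd : ℝ) (SigmaCoeff : ℕ → ℕ → X → ℝ) (α β : ℕ) : ℝ :=
  ∑ x : X, epsd * SigmaCoeff α β x

/-- The defining equation as printed holds for `dm2Coeff` (unfolding). [cite: Balaban1983Higgs3, (1.23) p.417] -/
theorem dm2Coeff_def (epsd : ℝ) (SigmaCoeff : ℕ → ℕ → X → ℝ) (α β : ℕ) :
    -dm2Coeff epsd SigmaCoeff α β + ∑ x : X, epsd * SigmaCoeff α β x = 0 := by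
  simp [dm2Coeff]

/-- **(1.23)** p. 417 [PDF 7]: *"δm² = Σ_{2≦α+2β≦4} e^αλ^β δm²_{(α,β)}"* with the coefficients of `dm2Coeff` — the mass
counterterm to order 4 (`epsd = ε^d`; the displayed list (1.23) of its lowest graphs is not reproduced).
[cite: Balaban1983Higgs3, (1.23) p.417] -/
def dm2Of123 (e lam epsd : ℝ) (SigmaCoeff : ℕ → ℕ → X → ℝ) : ℝ :=
  ∑ ab ∈ idx123, e ^ ab.1 * lam ^ ab.2 * dm2Coeff epsd SigmaCoeff ab.1 ab.2

/-- p. 417, verbatim: *"we define δm²_G by the equation −δm²_G + Σ_{x∈T_ε} ε^dΣ^ε_G(x) = 0. … If a graph G representing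
Σ^ε_G(x − x′) has the external legs localized in x, x′, then δm²_G = Σ_{x′∈T_ε} ε^dΣ^ε_G(x − x′) will be represented by the
same graph G but with both external legs localized in x and with the summation over x′"* — the per-graph counterterm
at `x` for a supplied two-point kernel `Σ_G(x, x′)`. [cite: Balaban1983Higgs3, (1.23) p.417] -/
def dm2Graph (epsd : ℝ) (SigmaG : X → X → ℝ) (x : X) : ℝ :=
  ∑ x' : X, epsd * SigmaG x x'

/-- For a translation-invariant kernel `Σ_G(x, x′) = s(x − x′)` on an additive group of sites the per-graph
counterterm does not depend on `x` (the paper's `δm²_G` is a number on `T_ε`). PROVED. [cite: Balaban1983Higgs3, (1.23) p.417] -/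
theorem dm2Graph_translationInvariant [AddCommGroup X] (epsd : ℝ) (s : X → ℝ) (x y : X) :
    dm2Graph epsd (fun u v => s (u - v)) x = dm2Graph epsd (fun u v => s (u - v)) y := by
  unfold dm2Graph
  have hx : ∑ x' : X, epsd * s (x - x') = ∑ z : X, epsd * s z :=
    Fintype.sum_equiv (Equiv.subLeft x) _ _ (fun _ => rfl)
  have hy : ∑ x' : X, epsd * s (y - x') = ∑ z : X, epsd * s z :=
    Fintype.sum_equiv (Equiv.subLeft y) _ _ (fun _ => rfl)
  rw [hx, hy]

end Eq123

/-! ## (1.24) — the vacuum-energy counterterm -/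

section Eq124

variable (D : ModelData) (P : Params)

/-- **(1.24)** p. 417 [PDF 7], verbatim: *"Now it is easy to define the vacuum energy counterterm E₁. It is defined by the
following perturbation expansion: E₁ = Σ_{1≦α+β≦n̄} (1/(α!β!)) e^αλ^β (∂^{α+β}/∂e^α∂λ^β log∫dA∫dφ e^{−S^ε(A,φ)})|_{e=λ=0}
(1.24)"* (p. 418: *"with n̄ > 12"*) — the same formula as (I.1.13) (there with `+E` under the logarithm, which cancels
the constant of (I.1.11)); decl of record = r14's CONCRETE `B1Sect1Statements.ModelData.e1`, named here for B3.
[cite: Balaban1983Higgs3, (1.24) p.417] -/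
noncomputable def E1of124 : ℝ :=
  D.e1 P

/-- Bridge between r14's (I.1.13)/(1.24) double sum and r12's double Taylor sum (I.3.62):
`E₁ = pertSum362 (log Z^ε) e λ n̄ − log Z^ε(0, 0)` (the `(0,0)` term of the full Taylor polynomial is the value at
zero couplings). PROVED. [cite: Balaban1983Higgs3, (1.24) p.417] -/
theorem e1_eq_pertSum362_sub :
    E1of124 D P = B1Sect3Statements.pertSum362 (D.logZ P) D.C.e D.lam D.nbar - D.logZ P 0 0 := by
  -- the common Taylor term of (I.1.13)/(1.24) and (I.3.62)
  set T : ℕ → ℕ → ℝ := fun α β =>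
    1 / ((Nat.factorial α : ℝ) * (Nat.factorial β : ℝ)) * D.C.e ^ α * D.lam ^ β *
      iteratedDeriv α (fun e' => iteratedDeriv β (fun lam' => D.logZ P e' lam') 0) 0 with hT
  set s : Finset (ℕ × ℕ) := Finset.range (D.nbar + 1) ×ˢ Finset.range (D.nbar + 1) with hs
  have hL : E1of124 D P = ∑ ab ∈ s, (if 1 ≤ ab.1 + ab.2 ∧ ab.1 + ab.2 ≤ D.nbar then T ab.1 ab.2 else 0) := by
    rw [hs, Finset.sum_product' (f := fun a b => if 1 ≤ a + b ∧ a + b ≤ D.nbar then T a b else 0)]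
    rfl
  have hR : B1Sect3Statements.pertSum362 (D.logZ P) D.C.e D.lam D.nbar
      = ∑ ab ∈ s, (if ab.1 + ab.2 ≤ D.nbar then T ab.1 ab.2 else 0) := by
    rw [B1Sect3Statements.pertSum362, Finset.sum_filter]
  rw [hL, hR]
  have h0 : ((0 : ℕ), (0 : ℕ)) ∈ s := by simp [hs]
  rw [← Finset.sum_erase_add _ _ h0,
    ← Finset.sum_erase_add s (fun ab => if ab.1 + ab.2 ≤ D.nbar then T ab.1 ab.2 else 0) h0]
  have hsum : ∑ ab ∈ s.erase (0, 0), (if 1 ≤ ab.1 + ab.2 ∧ ab.1 + ab.2 ≤ D.nbar then T ab.1 ab.2 else 0)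
      = ∑ ab ∈ s.erase (0, 0), (if ab.1 + ab.2 ≤ D.nbar then T ab.1 ab.2 else 0) := by
    refine Finset.sum_congr rfl fun ab hab => ?_
    have hne : ab ≠ (0, 0) := (Finset.mem_erase.mp hab).1
    have h1 : 1 ≤ ab.1 + ab.2 := by
      by_contra hlt
      apply hne
      ext <;> simp <;> omega
    simp [h1]
  have hT0 : T 0 0 = D.logZ P 0 0 := by simp [hT]
  rw [hsum]
  simp [hT0]

end Eq124

/-! ## (1.24) — repaired reading (v1.1): the decl of record after the semantic audit

v1.1 (append-only, r15 gen 11, 2026-08-22).  The typer's kernel-checked audit `B1Eq113OneSidedDerivatives` (p330976)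
shows that under Lean's total-function conventions `fun lam' => D.logZ P e' lam'` vanishes on `lam' < 0` (for `N ≥ 1`
the weight `exp(−S^ε)` is not integrable when `λ < 0`), so every `β ≥ 1` term of the TWO-SIDED Taylor sum `ModelData.e1`
— hence of `E1of124` above — is `0`: as typed, (1.24)'s `E₁` kept only its pure-`e` counterterms.  The print (p. 417:
*"defined by the following perturbation expansion"*) differentiates `log Z` in `λ` only at `λ = 0⁺`, i.e. FROM THE RIGHT.
The author of `B1Sect1Statements` repaired (I.1.13) append-only (v1.1, p331274): the decl of record is now
`ModelData.e1R`, with `iteratedDerivWithin β (fun lam' => logZ P e' lam') (Set.Ici 0) 0` for the `λ`-derivatives.  This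
section names it for B3.  `E1of124` and the bridge `e1_eq_pertSum362_sub` above are kept verbatim: the bridge is a true
identity between the two two-sided objects (`e1` and r12's `B1Sect3Statements.pertSum362`), both carrying the located
defect; a one-sided analogue of `pertSum362` is the business of `B1Sect3Statements`. -/

section Eq124R

variable (D : ModelData) (P : Params)

/-- **(1.24)** p. 417 [PDF 7] — *"E₁ = Σ_{1≦α+β≦n̄} (1/(α!β!)) e^αλ^β (∂^{α+β}/∂e^α∂λ^β log∫dA∫dφ e^{−S^ε(A,φ)})|_{e=λ=0}
(1.24)"* — in the REPAIRED READING of the semantic audit (typer p330976 / r01 p331274): the `λ`-derivatives are taken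
from the right at `λ = 0⁺` (`iteratedDerivWithin … (Set.Ici 0) 0`), the `e`-derivatives two-sidedly at `0`; decl of
record = r01's CONCRETE `B1Sect1Statements.ModelData.e1R`, named here for B3 (the twin of `E1of124`, which is the located
two-sided defect).  Honest scope (r01's v′): joint smoothness of `(e', λ') ↦ log Z` on `ℝ × [0, ∞)` — in particular the
regularity of the data `δm²` ((1.23)) — is not asserted; the order inner-`λ'`/outer-`e'` is a convention equal to the
printed mixed partial under joint smoothness. [cite: Balaban1983Higgs3, (1.24) p.417] -/
noncomputable def E1of124R : ℝ :=
  D.e1R P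

/-- `E1of124R` unfolds to r01's repaired `ModelData.e1R`. [cite: Balaban1983Higgs3, (1.24) p.417, dictionary] -/
theorem E1of124R_eq_e1R : E1of124R D P = D.e1R P := rfl

/-- The repaired (1.24) written out: the double sum over `1 ≤ α + β ≤ n̄` of
`(α!β!)⁻¹ e^α λ^β ∂_e^α [∂_λ^β|_{λ=0⁺} log Z^ε](0)`. [cite: Balaban1983Higgs3, (1.24) p.417] -/
theorem E1of124R_eq_sum :
    E1of124R D P = ∑ α ∈ Finset.range (D.nbar + 1), ∑ β ∈ Finset.range (D.nbar + 1),
      (if 1 ≤ α + β ∧ α + β ≤ D.nbar then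
        1 / ((Nat.factorial α : ℝ) * (Nat.factorial β : ℝ)) * D.C.e ^ α * D.lam ^ β *
          iteratedDeriv α (fun e' => iteratedDerivWithin β (fun lam' => D.logZ P e' lam') (Set.Ici 0) 0) 0
      else 0) := rfl

/-- The pure-`e` (`β = 0`) Taylor terms of the two readings coincide (r01's `e1R_term_beta_zero`): the located defect of
`E1of124` sits exactly in the `β ≥ 1` (`λ`-counterterm) terms. [cite: Balaban1983Higgs3, (1.24) p.417, dictionary] -/
theorem E1of124R_term_beta_zero (α : ℕ) :
    iteratedDeriv α (fun e' => iteratedDerivWithin 0 (fun lam' => D.logZ P e' lam') (Set.Ici 0) 0) 0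
      = iteratedDeriv α (fun e' => iteratedDeriv 0 (fun lam' => D.logZ P e' lam') 0) 0 :=
  D.e1R_term_beta_zero P α

end Eq124R

end Literature.MathematicalPhysics.QuantumFieldTheory.Balaban1983to89.B3Sect1TwoPoint
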